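import Summits.QuantumFields.YangMills.Theorems.SmallCircleAnchorAnchorGapStubDebyeScreening23

/-!
# Crux `AnchorGap` (stmt-QuantumFields-11141), line `registered` — block-decoupled covariance: factorisation and intrinsic marginal

In the Battle–Brydges–Federbush cluster expansion with COVARIANCE interpolation a fully decoupled
covariance `C` is block-diagonal along `S ⊔ Sᶜ`.  Then so is the precision `C⁻¹`, and its
`S × S` block is the inverse of the `S × S` block of `C`; hence

* (i) observables depending only on the `S`- (resp. `Sᶜ`-) coordinates are uncorrelated under the
  Gaussian with covariance `C` (`gaussian_integral_factorizes` of `…StubDebyeScreening20` for the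
  precision `C⁻¹`), and
* (ii) the expectation of an `S`-local observable is the Gaussian expectation on `ℝ^S` with
  covariance the restricted block `C_SS` (`gaussian_integral_factorizes_explicit` of
  `…StubDebyeScreening23`, the outside factor cancelling, and the zero-extension identity
  `(u ⊕ 0)ᵀ C⁻¹ (u ⊕ 0) = uᵀ (C_SS)⁻¹ u`),

so a polymer's activity depends only on the polymer: `stub_gaussianCovBlockFactor`.
-/

set_option autoImplicit false

noncomputable section

namespace Summit.QuantumFields.YangMills.Theorems.AnchorGap

open MeasureTheory Finset Matrix
open scoped Matrix

/-- A sum over `ι` of a function vanishing off `S` is the sum over the subtype `{i // i ∈ S}`.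
[folklore] -/
private lemma sum_eq_sum_subtype_of_zero {ι : Type} [Fintype ι] [DecidableEq ι] (S : Finset ι)
    (f : ι → ℝ) (hf : ∀ i, i ∉ S → f i = 0) : ∑ i, f i = ∑ a : {i // i ∈ S}, f a.1 := by
  rw [← Finset.sum_subset (Finset.subset_univ S) (fun i _ hi => hf i hi),
    Finset.sum_subtype S (fun _ => Iff.rfl)]

/-- **Quadratic form of a zero-extension.** For `u : S → ℝ` extended by zero to `ι`,
`(u ⊕ 0)ᵀ M (u ⊕ 0) = uᵀ M_SS u` with `M_SS` the `S × S` block of `M`. [folklore] -/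
private lemma ext_quadForm {ι : Type} [Fintype ι] [DecidableEq ι] (M : Matrix ι ι ℝ) (S : Finset ι)
    (u : {i // i ∈ S} → ℝ) :
    (fun i => if h : i ∈ S then u ⟨i, h⟩ else 0) ⬝ᵥ (M *ᵥ fun i => if h : i ∈ S then u ⟨i, h⟩ else 0) =
      u ⬝ᵥ ((M.submatrix Subtype.val Subtype.val) *ᵥ u) := by
  have hext : ∀ a : {i // i ∈ S}, (if h : a.1 ∈ S then u ⟨a.1, h⟩ else 0) = u a := fun a => by
    rw [dif_pos a.2]
  simp only [dotProduct, Matrix.mulVec, Matrix.submatrix_apply]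
  rw [sum_eq_sum_subtype_of_zero S _ (fun i hi => by simp [hi])]
  refine Finset.sum_congr rfl fun a _ => ?_
  rw [hext a, sum_eq_sum_subtype_of_zero S _ (fun j hj => by simp [hj])]
  congr 1
  refine Finset.sum_congr rfl fun b _ => ?_
  rw [hext b]

/-- **The inverse of a block-diagonal matrix is block-diagonal.** If the invertible `C` has no
entries between `S` and `Sᶜ`, neither has `C⁻¹` (`C` commutes with the coordinate projection onto
`S`, hence so does `C⁻¹`). [folklore] -/
private lemma inv_blockDiag {ι : Type} [Fintype ι] [DecidableEq ι] (C : Matrix ι ι ℝ)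
    (hC : IsUnit C.det) (S : Finset ι) (h0 : ∀ i j : ι, ¬ (i ∈ S ↔ j ∈ S) → C i j = 0) :
    ∀ i j : ι, ¬ (i ∈ S ↔ j ∈ S) → C⁻¹ i j = 0 := by
  set E : Matrix ι ι ℝ := Matrix.diagonal fun i => if i ∈ S then (1 : ℝ) else 0 with hE
  have hcomm : E * C = C * E := by
    ext i j
    simp only [hE, Matrix.diagonal_mul, Matrix.mul_diagonal]
    by_cases hi : i ∈ S <;> by_cases hj : j ∈ S
    · simp [hi, hj]
    · simp [hi, hj, h0 i j (by simp [hi, hj])]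
    · simp [hi, hj, h0 i j (by simp [hi, hj])]
    · simp [hi, hj]
  have hcomm' : C⁻¹ * E = E * C⁻¹ := by
    calc C⁻¹ * E = C⁻¹ * E * (C * C⁻¹) := by rw [Matrix.mul_nonsing_inv _ hC, Matrix.mul_one]
      _ = C⁻¹ * (E * C) * C⁻¹ := by simp only [Matrix.mul_assoc]
      _ = C⁻¹ * (C * E) * C⁻¹ := by rw [hcomm]
      _ = E * C⁻¹ := by rw [← Matrix.mul_assoc, Matrix.nonsing_inv_mul _ hC, Matrix.one_mul]
  intro i j hij
  have h := congrFun (congrFun hcomm' i) j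
  simp only [hE, Matrix.mul_diagonal, Matrix.diagonal_mul] at h
  by_cases hi : i ∈ S <;> by_cases hj : j ∈ S
  · exact absurd (iff_of_true hi hj) hij
  · simpa [hi, hj] using h.symm
  · simpa [hi, hj] using h
  · exact absurd (iff_of_false hi hj) hij

/-- **The `S × S` block of the inverse of a block-diagonal matrix is the inverse of the `S × S`
block.** If the invertible `C` has no entries from `Sᶜ` to `S`, then `(C_SS)⁻¹ = (C⁻¹)_SS`
(`(C⁻¹)_SS C_SS = (C⁻¹ C)_SS = 1`). [folklore] -/
private lemma inv_submatrix {ι : Type} [Fintype ι] [DecidableEq ι] (C : Matrix ι ι ℝ)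
    (hC : IsUnit C.det) (S : Finset ι) (h0 : ∀ i j : ι, ¬ (i ∈ S ↔ j ∈ S) → C i j = 0) :
    (C.submatrix (Subtype.val : {i // i ∈ S} → ι) (Subtype.val : {i // i ∈ S} → ι))⁻¹ =
      C⁻¹.submatrix (Subtype.val : {i // i ∈ S} → ι) (Subtype.val : {i // i ∈ S} → ι) := by
  refine Matrix.inv_eq_left_inv ?_
  ext a b
  simp only [Matrix.mul_apply, Matrix.submatrix_apply]
  rw [← sum_eq_sum_subtype_of_zero S (fun j => C⁻¹ a.1 j * C j b.1)
    (fun j hj => by rw [h0 j b.1 (by simp [hj, b.2]), mul_zero]), ← Matrix.mul_apply,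
    Matrix.nonsing_inv_mul _ hC]
  change ((1 : Matrix ι ι ℝ).submatrix Subtype.val Subtype.val) a b = _
  rw [Matrix.submatrix_one _ Subtype.val_injective]

/-- **Block-decoupled covariance: factorisation and intrinsic marginal.** Let `C` be a positive
definite covariance on `ι → ℝ` with no entries between `S` and `Sᶜ`, `F` an observable depending
only on the `S`-coordinates and `G` one depending only on the others, and `⟨·⟩` the normalised
Gaussian expectation with weight `e^{−½ φᵀ C⁻¹ φ}`.  Then (i) `⟨F G⟩ = ⟨F⟩ ⟨G⟩`, and (ii) `⟨F⟩`
equals the normalised Gaussian expectation of `u ↦ F(u ⊕ 0)` on `ℝ^S` with weight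
`e^{−½ uᵀ (C_SS)⁻¹ u}`, `C_SS` the `S × S` block of `C`: the precision `C⁻¹` is block-diagonal with
`(C⁻¹)_SS = (C_SS)⁻¹`, the Gaussian integrals split over `(S → ℝ) × (Sᶜ → ℝ)`, and the outside
factor cancels.  In the cluster expansion with covariance decoupling this is why a polymer's
activity depends only on the polymer. [folklore] -/
theorem stub_gaussianCovBlockFactor : ∀ (ι : Type) [Fintype ι] [DecidableEq ι] (C : Matrix ι ι ℝ), C.PosDef → ∀ (S : Finset ι), (∀ i j : ι, ¬ (i ∈ S ↔ j ∈ S) → C i j = 0) → ∀ (F G : (ι → ℝ) → ℝ), (∀ φ ψ : ι → ℝ, (∀ i ∈ S, φ i = ψ i) → F φ = F ψ) → (∀ φ ψ : ι → ℝ, (∀ i, i ∉ S → φ i = ψ i) → G φ = G ψ) → (∫ φ : ι → ℝ, F φ * G φ * Real.exp (-(φ ⬝ᵥ (C⁻¹ *ᵥ φ)) / 2)) / (∫ φ : ι → ℝ, Real.exp (-(φ ⬝ᵥ (C⁻¹ *ᵥ φ)) / 2)) = ((∫ φ : ι → ℝ, F φ * Real.exp (-(φ ⬝ᵥ (C⁻¹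 *ᵥ φ)) / 2)) / ∫ φ : ι → ℝ, Real.exp (-(φ ⬝ᵥ (C⁻¹ *ᵥ φ)) / 2)) * ((∫ φ : ι → ℝ, G φ * Real.exp (-(φ ⬝ᵥ (C⁻¹ *ᵥ φ)) / 2)) / ∫ φ : ι → ℝ, Real.exp (-(φ ⬝ᵥ (C⁻¹ *ᵥ φ)) / 2)) ∧ (∫ φ : ι → ℝ, F φ * Real.exp (-(φ ⬝ᵥ (C⁻¹ *ᵥ φ)) / 2)) / (∫ φ : ι → ℝ, Real.exp (-(φ ⬝ᵥ (C⁻¹ *ᵥ φ)) / 2)) = (∫ u : {i // i ∈ S} → ℝ, F (fun i => if h : i ∈ S then u ⟨i, h⟩ else 0) * Real.exp (-(u ⬝ᵥ ((C.submatrix Subtype.val Subtype.val)⁻¹ *ᵥ u)) / 2)) / ∫ u : {i // i ∈ S} → ℝ, Real.exp (-(u ⬝ᵥ ((C.submatrix Subtype.val Subtype.val)⁻¹ *ᵥ u)) / 2) := by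
  intro ι _ _ C hC S h0 F G hF hG
  have hdet : IsUnit C.det := (Matrix.isUnit_iff_isUnit_det C).1 hC.isUnit
  have hQ : C⁻¹.PosDef := hC.inv
  have hQ0 : ∀ i j : ι, ¬ (i ∈ S ↔ j ∈ S) → C⁻¹ i j = 0 := inv_blockDiag C hdet S h0
  -- the partition function is positive
  have hZ := (gaussian_second_moment ι C⁻¹ hQ).1
  refine ⟨?_, ?_⟩
  · -- (i) independence of the two blocks
    have hfac := gaussian_integral_factorizes ι C⁻¹ S hQ0 F G hF hG
    rw [div_mul_div_comm, ← hfac, mul_div_mul_right _ _ hZ.ne']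
  · -- (ii) the marginal on `S` is the Gaussian of the block `C_SS`
    have hF1 := gaussian_integral_factorizes_explicit ι C⁻¹ S hQ0 F (fun _ => 1) hF (fun _ _ _ => rfl)
    have h11 := gaussian_integral_factorizes_explicit ι C⁻¹ S hQ0 (fun _ => 1) (fun _ => 1)
      (fun _ _ _ => rfl) (fun _ _ _ => rfl)
    simp only [one_mul, mul_one] at hF1 h11
    have hZ' := hZ
    rw [h11] at hZ'
    have hB : (∫ v : {i // ¬ i ∈ S} → ℝ, Real.exp (-((fun i => if h : i ∈ S then 0 else v ⟨i, h⟩) ⬝ᵥ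
        (C⁻¹ *ᵥ fun i => if h : i ∈ S then 0 else v ⟨i, h⟩)) / 2)) ≠ 0 := by
      intro h; rw [h, mul_zero] at hZ'; exact lt_irrefl _ hZ'
    rw [hF1, h11, mul_div_mul_right _ _ hB]
    simp_rw [ext_quadForm C⁻¹ S, inv_submatrix C hdet S h0]

end Summit.QuantumFields.YangMills.Theorems.AnchorGap

end
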